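import Summits.ResolutionOfSingularities.ResolutionOfSingularities.Theorems.FrobeniusLadderFInjectiveMacaulayficationPointFixDimOne
import Summits.ResolutionOfSingularities.ResolutionOfSingularities.Theorems.FrobeniusLadderFInjectiveMacaulayficationStalkNormalizationFinite
import Literature.AlgebraicGeometry.Resolution.AlterationsBoundarySmoothLocus
import HarnessLib

/-!
# 5e IN DIMENSION ONE, unconditional for varieties: the `h4Loc` binder at the closed points of a curve
# (crux `FInjectiveMacaulayfication` stmt-ResolutionOfSingularities-15315, chain w45a, plan-1 R13.14 (3), assembly)

[OURS · L1 W4.5a · res-D-pv-019 AS res-L1-w45a-stub-7] Support file (`--supports stmt-ResolutionOfSingularities-15315 --as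
helper`) for the crux `FrobeniusLadder.FInjectiveMacaulayfication`; NOT a statement of any manuscript; AI-written, weaker than
expert review.

Assembly of `PointFixDimOne.h4Loc_of_dim_one` (5e at a point `b` with `dim 𝒪_{X₁,b} = 1`, modulo finiteness of the normalisation
of `𝒪_{X₁,b}`) with `StalkNormalizationFinite.module_finite_integralClosure_stalk` (that finiteness, from E. Noether) and the
tree's `ringKrullDim_stalk_eq_of_isClosed` (`dim 𝒪_{X₁,b} = dim X₁` at closed points of a variety):

* `h4Loc_of_dim_one_variety` — `X₁` integral, locally of finite type over a field of characteristic `p`, `b ∈ X₁` with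
  `dim 𝒪_{X₁,b} = 1` ⇒ the `h4Loc` conclusion at `b` (VERBATIM), with NO further hypothesis;
* `h4Loc_of_curve` — the `h4Loc` binder of `GenericFibreReduction.fInjectiveMacaulayfication_of_h4Loc_of_fc_named` in its own
  shape, for every `X₁` of dimension `1` (a curve): 5e HOLDS IN DIMENSION ONE (base case of the crux's induction on `dim X₁`;
  the standing hypotheses «all stalks CM», «finite bad set», «`b` not FULL» are not even used).
No sorry, no definitions, no named facts.
-/

-- single-problem summit: the doubled namespace component is forced
set_option linter.dupNamespace false

noncomputable section

open IsLocalRing Literature.AlgebraicGeometry.Resolution AlgebraicGeometry CategoryTheory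
open Summit.ResolutionOfSingularities.ResolutionOfSingularities.Theorems.FInjectiveMacaulayfication

namespace Summit.ResolutionOfSingularities.ResolutionOfSingularities.Theorems.FInjectiveMacaulayfication.PointFixDimOneVariety

/-- **5e at a one-dimensional point of a variety, unconditionally.** For `X₁` integral and locally of finite type over a field `k`
of prime characteristic `p` and `b ∈ X₁` with `dim 𝒪_{X₁,b} = 1`, the conclusion of the `h4Loc` binder holds at `b`: generators `c`
of a nonzero ideal of `𝒪_{X₁,b}` with radical `𝔪_b` such that every local ring of every blow-up chart `𝒪_{X₁,b}[(c)/c_j]` at a prime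
over `𝔪_b` is a domain satisfying the FULL clause (`PointFixDimOne.h4Loc_of_dim_one` + E. Noether
`StalkNormalizationFinite.module_finite_integralClosure_stalk`). [folklore] -/
theorem h4Loc_of_dim_one_variety (p : ℕ) (hp : p.Prime) (k : Type) [Field k] [CharP k p] (X₁ : Scheme.{0})
    (f₁ : X₁ ⟶ Spec (.of k)) [LocallyOfFiniteType f₁] [IsIntegral X₁] (b : X₁)
    (hdim : ringKrullDim (X₁.presheaf.stalk b) = 1) :
    ∃ (n : ℕ) (c : Fin n → X₁.presheaf.stalk b), Ideal.span (Set.range c) ≠ ⊥ ∧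
      (Ideal.span (Set.range c)).radical = IsLocalRing.maximalIdeal (X₁.presheaf.stalk b) ∧
      ∀ (j : Fin n) (𝔔 : PrimeSpectrum (Literature.AlgebraicGeometry.Resolution.blowupAlgebra (Ideal.span (Set.range c)) (c j))),
        𝔔.asIdeal.comap (algebraMap (X₁.presheaf.stalk b)
            (Literature.AlgebraicGeometry.Resolution.blowupAlgebra (Ideal.span (Set.range c)) (c j))) =
          IsLocalRing.maximalIdeal (X₁.presheaf.stalk b) →
        IsDomain (Localization.AtPrime 𝔔.asIdeal) ∧ ∀ d : ℕ, ringKrullDim (Localization.AtPrime 𝔔.asIdeal) = d →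
          ∀ s : Fin d → Localization.AtPrime 𝔔.asIdeal, (Ideal.span (Set.range s)).radical.IsMaximal →
            RingTheory.Sequence.IsWeaklyRegular (Localization.AtPrime 𝔔.asIdeal) (List.ofFn s) ∧
            ∀ y : Localization.AtPrime 𝔔.asIdeal, (∃ e : ℕ, y ^ p ^ e ∈ Ideal.span
              ((fun z : Localization.AtPrime 𝔔.asIdeal => z ^ p ^ e) ''
                (Ideal.span (Set.range s) : Set (Localization.AtPrime 𝔔.asIdeal)))) → y ∈ Ideal.span (Set.range s) :=
  PointFixDimOne.h4Loc_of_dim_one p hp k X₁ f₁ b hdim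
    (StalkNormalizationFinite.module_finite_integralClosure_stalk k X₁ f₁ b)

/-- **5e HOLDS IN DIMENSION ONE** — the `h4Loc` binder of `GenericFibreReduction.fInjectiveMacaulayfication_of_h4Loc_of_fc_named`
in its own shape for CURVES: for every prime `p`, field `k` of characteristic `p` and `X₁ → Spec k` separated, locally of finite
type, quasi-compact, integral, OF DIMENSION `1`, and every closed point `b` (the hypotheses «all stalks CM», «finite bad set» and
«`b` not FULL» of the binder are carried but not used), the point-fixability conclusion holds at `b`
(`h4Loc_of_dim_one_variety`; `dim 𝒪_{X₁,b} = dim X₁ = 1` at closed points, tree `ringKrullDim_stalk_eq_of_isClosed`). [folklore] -/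
theorem h4Loc_of_curve : ∀ (p : ℕ), p.Prime → ∀ (k : Type) [Field k] [CharP k p]
    (X₁ : Scheme.{0}) (f₁ : X₁ ⟶ Spec (.of k)),
    IsSeparated f₁ → LocallyOfFiniteType f₁ → QuasiCompact f₁ → IsIntegral X₁ →
    topologicalKrullDim X₁ = 1 →
    (∀ x : X₁, ∀ d : ℕ, ringKrullDim (X₁.presheaf.stalk x) = d → ∀ s : Fin d → X₁.presheaf.stalk x,
      (Ideal.span (Set.range s)).radical.IsMaximal → RingTheory.Sequence.IsWeaklyRegular (X₁.presheaf.stalk x) (List.ofFn s)) →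
    Set.Finite {x : X₁ | ¬ ∀ d : ℕ, ringKrullDim (X₁.presheaf.stalk x) = d → ∀ s : Fin d → X₁.presheaf.stalk x,
      (Ideal.span (Set.range s)).radical.IsMaximal → ∀ y : X₁.presheaf.stalk x, (∃ e : ℕ, y ^ p ^ e ∈ Ideal.span
        ((fun z : X₁.presheaf.stalk x => z ^ p ^ e) '' (Ideal.span (Set.range s) : Set (X₁.presheaf.stalk x)))) →
          y ∈ Ideal.span (Set.range s)} →
    ∀ b : X₁, IsClosed ({b} : Set X₁) →
      (¬ ∀ d : ℕ, ringKrullDim (X₁.presheaf.stalk b) = d → ∀ s : Fin d → X₁.presheaf.stalk b,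
        (Ideal.span (Set.range s)).radical.IsMaximal → ∀ y : X₁.presheaf.stalk b, (∃ e : ℕ, y ^ p ^ e ∈ Ideal.span
          ((fun z : X₁.presheaf.stalk b => z ^ p ^ e) '' (Ideal.span (Set.range s) : Set (X₁.presheaf.stalk b)))) →
            y ∈ Ideal.span (Set.range s)) →
      ∃ (n : ℕ) (c : Fin n → X₁.presheaf.stalk b), Ideal.span (Set.range c) ≠ ⊥ ∧
        (Ideal.span (Set.range c)).radical = IsLocalRing.maximalIdeal (X₁.presheaf.stalk b) ∧
        ∀ (j : Fin n) (𝔔 : PrimeSpectrum (Literature.AlgebraicGeometry.Resolution.blowupAlgebra (Ideal.span (Set.range c)) (c j))),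
          𝔔.asIdeal.comap (algebraMap (X₁.presheaf.stalk b)
              (Literature.AlgebraicGeometry.Resolution.blowupAlgebra (Ideal.span (Set.range c)) (c j))) =
            IsLocalRing.maximalIdeal (X₁.presheaf.stalk b) →
          IsDomain (Localization.AtPrime 𝔔.asIdeal) ∧ ∀ d : ℕ, ringKrullDim (Localization.AtPrime 𝔔.asIdeal) = d →
            ∀ s : Fin d → Localization.AtPrime 𝔔.asIdeal, (Ideal.span (Set.range s)).radical.IsMaximal →
              RingTheory.Sequence.IsWeaklyRegular (Localization.AtPrime 𝔔.asIdeal) (List.ofFn s) ∧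
              ∀ y : Localization.AtPrime 𝔔.asIdeal, (∃ e : ℕ, y ^ p ^ e ∈ Ideal.span
                ((fun z : Localization.AtPrime 𝔔.asIdeal => z ^ p ^ e) ''
                  (Ideal.span (Set.range s) : Set (Localization.AtPrime 𝔔.asIdeal)))) → y ∈ Ideal.span (Set.range s) := by
  intro p hp k _ _ X₁ f₁ _ _ _ _ hdim1 _ _ b hb _
  have hdim : ringKrullDim (X₁.presheaf.stalk b) = 1 := by
    rw [ringKrullDim_stalk_eq_of_isClosed f₁ hb, hdim1]
  exact h4Loc_of_dim_one_variety p hp k X₁ f₁ b hdim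

end Summit.ResolutionOfSingularities.ResolutionOfSingularities.Theorems.FInjectiveMacaulayfication.PointFixDimOneVariety

end
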